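import Summits.BirchSwinnertonDyer.Rank1Residual.ManinAdditive.KummerDiamondShapeLaws
import HarnessLib

/-!
# The 2-descent SHAPE ALGEBRA of E-es-185 STEP 3 (MEMO-es §59.5 / §59.13(b)): `E`-free kernel lemmas
(route `ManinLocalTwoThree`, crux C2 `ManinOddAtFour` stmt-BirchSwinnertonDyer-22967; cell bsd-f2-manin, C2/C3 LEAD p1 gen 19;
`--supports stmt-BirchSwinnertonDyer-22967`; line of record `Lines/kummer_diamond.lean` — port plan of the one open stub
`stub_indexFourForcesFreyTwistShape` = {THEOREM K row, LEMMA M ✓ p758315, 2-descent dictionary, THIS FILE, Tate-186♭ ✓ p758063,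
E-an-152d ✓ p757495})

es g38's EXCLUSION THEOREM ends (STEP 3, cases (ii) and (iii-h₁)) with three pieces of elementary algebra, isolated here so that the
eventual Lean port of E-es-185 `KummerDiamond.IndexFourForcesFreyTwistShape` only has to supply the `E`-side dictionary:

* §1 `hasFreyTwistShape_of_twoTorsion_differences` — if `a₁ = a₃ = 0` and the 2-division cubic of `W` splits as
  `(x − e₁)(x − e₂)(x − e₃)` with `e₂ − e₁ = 2(μs)²`, `e₃ − e₁ = (μt)²`, `μ ≠ 0`, `s` even, `t` odd, then the explicit change of
  variables `⟨μ, e₁, 0, 0⟩` carries `W` to `freyTwistCurve s t`: `HasFreyTwistShape W`.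
* §2 `exists_two_primitive_scaling` — three rationals, not all zero, are a common rational multiple of a 2-PRIMITIVE integer triple
  (the «WLOG primitive» of §59.13(b)).
* §3 the two mod-8 normalisations of §59.13(b): a 2-primitive solution of `u² + p·w² = 2m²` with `p ≡ 3 (mod 4)` has `u, w` odd,
  `m` even and forces `p ≡ 7 (mod 8)` (`parity_of_sq_add_mul_sq_eq_two_mul_sq`; no 2-primitive solution when `p ≡ 3 (mod 8)`);
  a 2-primitive solution of `b² = 2a² + c²` has `a` even and `b, c` odd (`parity_of_sq_eq_two_mul_sq_add_sq`).

HONEST FRAMING: SUPPORT lemmas only (elementary; the arithmetic input THEOREM K = Stevens 1982 Thm. 1.3.1(b) and the 2-descent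
dictionary are NOT here); nothing about C2, Manin's conjecture or BSD is proved by this file; C2/C3 OPEN as filed.
-/

set_option autoImplicit false
-- lint-debt: the directory name repeats the summit name (sibling precedent `ManinLocalTwoThreeFreyTwistShapeConductorAtTwo.lean`)
set_option linter.dupNamespace false

noncomputable section

open WeierstrassCurve
open Summit.BirchSwinnertonDyer.Rank1Residual.ManinAdditive.KummerDiamond

namespace Summit.BirchSwinnertonDyer.BirchSwinnertonDyer.Theorems.ManinLocalTwoThree.KummerDiamondShape

/-! ## §1 From split 2-torsion with differences `2(μs)²`, `(μt)²` to the Frey-twist shape -/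

/-- Vieta for a monic cubic that splits: `a₂ = −(e₁+e₂+e₃)`, `a₄ = e₁e₂ + e₁e₃ + e₂e₃`, `a₆ = −e₁e₂e₃`. [folklore] -/
theorem vieta_of_cubic_splits {a₂ a₄ a₆ e₁ e₂ e₃ : ℚ}
    (hsplit : ∀ x : ℚ, x ^ 3 + a₂ * x ^ 2 + a₄ * x + a₆ = (x - e₁) * (x - e₂) * (x - e₃)) :
    a₂ = -(e₁ + e₂ + e₃) ∧ a₄ = e₁ * e₂ + e₁ * e₃ + e₂ * e₃ ∧ a₆ = -(e₁ * e₂ * e₃) := by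
  have h0 := hsplit 0
  have h1 := hsplit 1
  have h2 := hsplit (-1)
  refine ⟨?_, ?_, ?_⟩
  · linear_combination (h1 + h2) / 2 - h0
  · linear_combination (h1 - h2) / 2
  · linear_combination h0

/-- **Shape lemma (E-es-185 STEP 3, last line of §59.13(b)).** Let `W/ℚ` have `a₁ = a₃ = 0` and 2-division cubic
`x³ + a₂x² + a₄x + a₆ = (x − e₁)(x − e₂)(x − e₃)` with `e₂ − e₁ = 2(μs)²`, `e₃ − e₁ = (μt)²`, `μ ≠ 0`, `s` even, `t` odd.  Then the
change of variables `(u, r, s, t) = (μ, e₁, 0, 0)` («an INTEGRAL dilation + translation») gives `y² = x(x − 2s²)(x − t²)`: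
`HasFreyTwistShape W`. [cite: Stevens1989, §2] -/
theorem hasFreyTwistShape_of_twoTorsion_differences (W : WeierstrassCurve ℚ) (h₁ : W.a₁ = 0) (h₃ : W.a₃ = 0)
    {e₁ e₂ e₃ : ℚ} (hsplit : ∀ x : ℚ, x ^ 3 + W.a₂ * x ^ 2 + W.a₄ * x + W.a₆ = (x - e₁) * (x - e₂) * (x - e₃))
    {μ : ℚ} (hμ : μ ≠ 0) {s t : ℤ} (hs : Even s) (ht : Odd t)
    (h₂₁ : e₂ - e₁ = 2 * (μ * s) ^ 2) (h₃₁ : e₃ - e₁ = (μ * t) ^ 2) : HasFreyTwistShape W := by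
  obtain ⟨ha₂, ha₄, ha₆⟩ := vieta_of_cubic_splits hsplit
  -- `μ⁻ⁿ X = Y ⟸ X = μⁿ Y`
  have key : ∀ {X Y : ℚ} (n : ℕ), X = μ ^ n * Y → (μ⁻¹) ^ n * X = Y := by
    intro X Y n h
    rw [h, ← mul_assoc, ← mul_pow, inv_mul_cancel₀ hμ, one_pow, one_mul]
  refine ⟨s, t, ⟨Units.mk0 μ hμ, e₁, 0, 0⟩, hs, ht, ?_⟩
  ext
  · -- a₁
    rw [WeierstrassCurve.variableChange_a₁]
    show ((Units.mk0 μ hμ)⁻¹ : ℚˣ).val * (W.a₁ + 2 * 0) = 0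
    rw [h₁]; ring
  · -- a₂
    rw [WeierstrassCurve.variableChange_a₂]
    show ((Units.mk0 μ hμ)⁻¹ : ℚˣ).val ^ 2 * (W.a₂ - 0 * W.a₁ + 3 * e₁ - 0 ^ 2) = -((2 * s ^ 2 + t ^ 2 : ℤ) : ℚ)
    rw [Units.val_inv_eq_inv_val, Units.val_mk0]
    refine key 2 ?_
    rw [ha₂, h₁]
    push_cast
    linear_combination (-1 : ℚ) * h₂₁ - h₃₁
  · -- a₃
    rw [WeierstrassCurve.variableChange_a₃]
    show ((Units.mk0 μ hμ)⁻¹ : ℚˣ).val ^ 3 * (W.a₃ + e₁ * W.a₁ + 2 * 0) = 0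
    rw [h₁, h₃]; ring
  · -- a₄
    rw [WeierstrassCurve.variableChange_a₄]
    show ((Units.mk0 μ hμ)⁻¹ : ℚˣ).val ^ 4 *
        (W.a₄ - 0 * W.a₃ + 2 * e₁ * W.a₂ - (0 + e₁ * 0) * W.a₁ + 3 * e₁ ^ 2 - 2 * 0 * 0) =
      ((2 * s ^ 2 * t ^ 2 : ℤ) : ℚ)
    rw [Units.val_inv_eq_inv_val, Units.val_mk0]
    refine key 4 ?_
    rw [ha₄, ha₂, h₁]
    push_cast
    linear_combination (e₂ - e₁) * h₃₁ + (μ * t) ^ 2 * h₂₁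
  · -- a₆
    rw [WeierstrassCurve.variableChange_a₆]
    show ((Units.mk0 μ hμ)⁻¹ : ℚˣ).val ^ 6 *
        (W.a₆ + e₁ * W.a₄ + e₁ ^ 2 * W.a₂ + e₁ ^ 3 - 0 * W.a₃ - 0 ^ 2 - e₁ * 0 * W.a₁) =
      ((0 : ℤ) : ℚ)
    rw [Units.val_inv_eq_inv_val, Units.val_mk0]
    refine key 6 ?_
    rw [ha₆, ha₄, ha₂]
    push_cast
    ring

/-- The shape lemma with the rôles of the two differences swapped (`e₂ − e₁ = (μt)²`, `e₃ − e₁ = 2(μs)²`), for the caller's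
convenience (case (ii) of §59.5 lists the roots as `e₁, e₁ + u², e₁ + 2m²`). [cite: Stevens1989, §2] -/
theorem hasFreyTwistShape_of_twoTorsion_differences' (W : WeierstrassCurve ℚ) (h₁ : W.a₁ = 0) (h₃ : W.a₃ = 0)
    {e₁ e₂ e₃ : ℚ} (hsplit : ∀ x : ℚ, x ^ 3 + W.a₂ * x ^ 2 + W.a₄ * x + W.a₆ = (x - e₁) * (x - e₂) * (x - e₃))
    {μ : ℚ} (hμ : μ ≠ 0) {s t : ℤ} (hs : Even s) (ht : Odd t)
    (h₂₁ : e₂ - e₁ = (μ * t) ^ 2) (h₃₁ : e₃ - e₁ = 2 * (μ * s) ^ 2) : HasFreyTwistShape W :=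
  hasFreyTwistShape_of_twoTorsion_differences W h₁ h₃ (e₁ := e₁) (e₂ := e₃) (e₃ := e₂)
    (fun x => by rw [hsplit x]; ring) hμ hs ht h₃₁ h₂₁

/-! ## §2 WLOG 2-primitive: common rational scaling of three rationals -/

/-- Every integer triple, not all zero, is `2^k` times a 2-PRIMITIVE triple (not all even). [folklore] -/
theorem exists_two_pow_mul_two_primitive (n₁ n₂ n₃ : ℤ) (h : ¬ (n₁ = 0 ∧ n₂ = 0 ∧ n₃ = 0)) :
    ∃ (k : ℕ) (u w m : ℤ), n₁ = 2 ^ k * u ∧ n₂ = 2 ^ k * w ∧ n₃ = 2 ^ k * m ∧ ¬ (2 ∣ u ∧ 2 ∣ w ∧ 2 ∣ m) := by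
  induction hS : n₁.natAbs + n₂.natAbs + n₃.natAbs using Nat.strong_induction_on generalizing n₁ n₂ n₃ with
  | _ S ih =>
    by_cases hall : 2 ∣ n₁ ∧ 2 ∣ n₂ ∧ 2 ∣ n₃
    · obtain ⟨⟨a, rfl⟩, ⟨b, rfl⟩, ⟨c, rfl⟩⟩ := hall
      have habc : ¬ (a = 0 ∧ b = 0 ∧ c = 0) := by
        rintro ⟨rfl, rfl, rfl⟩; exact h ⟨by ring, by ring, by ring⟩
      have hlt : a.natAbs + b.natAbs + c.natAbs < S := by
        rw [← hS, Int.natAbs_mul, Int.natAbs_mul, Int.natAbs_mul]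
        have : a.natAbs + b.natAbs + c.natAbs ≠ 0 := by
          intro h0
          exact habc ⟨Int.natAbs_eq_zero.mp (by omega), Int.natAbs_eq_zero.mp (by omega), Int.natAbs_eq_zero.mp (by omega)⟩
        simp only [Int.reduceAbs]
        omega
      obtain ⟨k, u, w, m, hu, hw, hm, hp⟩ := ih _ hlt a b c habc rfl
      exact ⟨k + 1, u, w, m, by rw [hu]; ring, by rw [hw]; ring, by rw [hm]; ring, hp⟩
    · exact ⟨0, n₁, n₂, n₃, by ring, by ring, by ring, hall⟩

/-- **WLOG primitive (§59.13(b)).** Three rationals, not all zero, are `μ·(u, w, m)` for one rational `μ ≠ 0` and a 2-PRIMITIVE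
integer triple `(u, w, m)` (not all even). [folklore] -/
theorem exists_two_primitive_scaling (q₁ q₂ q₃ : ℚ) (h : ¬ (q₁ = 0 ∧ q₂ = 0 ∧ q₃ = 0)) :
    ∃ (μ : ℚ) (u w m : ℤ), μ ≠ 0 ∧ q₁ = μ * u ∧ q₂ = μ * w ∧ q₃ = μ * m ∧ ¬ (2 ∣ u ∧ 2 ∣ w ∧ 2 ∣ m) := by
  -- common denominator
  set D : ℤ := (q₁.den : ℤ) * q₂.den * q₃.den with hD
  have hD0 : (D : ℚ) ≠ 0 := by
    rw [hD]; push_cast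
    exact mul_ne_zero (mul_ne_zero (Nat.cast_ne_zero.mpr q₁.den_nz) (Nat.cast_ne_zero.mpr q₂.den_nz))
      (Nat.cast_ne_zero.mpr q₃.den_nz)
  set n₁ : ℤ := q₁.num * q₂.den * q₃.den with hn₁
  set n₂ : ℤ := q₁.den * q₂.num * q₃.den with hn₂
  set n₃ : ℤ := q₁.den * q₂.den * q₃.num with hn₃
  have e₁ : q₁ * D = n₁ := by
    rw [hD, hn₁]; push_cast
    rw [← mul_assoc, ← mul_assoc, Rat.mul_den_eq_num]
  have e₂ : q₂ * D = n₂ := by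
    rw [hD, hn₂]; push_cast
    rw [show q₂ * ((q₁.den : ℚ) * q₂.den * q₃.den) = q₁.den * (q₂ * q₂.den) * q₃.den by ring, Rat.mul_den_eq_num]
  have e₃ : q₃ * D = n₃ := by
    rw [hD, hn₃]; push_cast
    rw [show q₃ * ((q₁.den : ℚ) * q₂.den * q₃.den) = q₁.den * q₂.den * (q₃ * q₃.den) by ring, Rat.mul_den_eq_num]
  have hn : ¬ (n₁ = 0 ∧ n₂ = 0 ∧ n₃ = 0) := by
    rintro ⟨z₁, z₂, z₃⟩
    refine h ⟨?_, ?_, ?_⟩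
    · have := e₁; rw [z₁, Int.cast_zero, mul_eq_zero] at this; exact this.resolve_right hD0
    · have := e₂; rw [z₂, Int.cast_zero, mul_eq_zero] at this; exact this.resolve_right hD0
    · have := e₃; rw [z₃, Int.cast_zero, mul_eq_zero] at this; exact this.resolve_right hD0
  obtain ⟨k, u, w, m, hu, hw, hm, hp⟩ := exists_two_pow_mul_two_primitive n₁ n₂ n₃ hn
  refine ⟨(2 : ℚ) ^ k / D, u, w, m, div_ne_zero (pow_ne_zero _ two_ne_zero) hD0, ?_, ?_, ?_, hp⟩
  · rw [div_mul_eq_mul_div, eq_div_iff hD0, e₁, hu]; push_cast; ring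
  · rw [div_mul_eq_mul_div, eq_div_iff hD0, e₂, hw]; push_cast; ring
  · rw [div_mul_eq_mul_div, eq_div_iff hD0, e₃, hm]; push_cast; ring

/-! ## §3 The two mod-8 normalisations -/

/-- `z ↦ z mod 8` with the parity remembered. [folklore] -/
theorem exists_emod_eight (z : ℤ) :
    ∃ r : ℤ, 0 ≤ r ∧ r < 8 ∧ (z : ZMod 8) = (r : ZMod 8) ∧ z % 2 = r % 2 ∧ z % 4 = r % 4 ∧ z % 8 = r :=
  ⟨z % 8, Int.emod_nonneg _ (by norm_num), Int.emod_lt_of_pos _ (by norm_num), (ZMod.intCast_mod z 8).symm,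
    by omega, by omega, rfl⟩

/-- `z` is odd iff `z mod 8 ∈ {1, 3, 5, 7}`. [folklore] -/
theorem odd_iff_cast_zmod_eight (z : ℤ) :
    Odd z ↔ ((z : ZMod 8) = 1 ∨ (z : ZMod 8) = 3 ∨ (z : ZMod 8) = 5 ∨ (z : ZMod 8) = 7) := by
  obtain ⟨r, hr0, hr8, hz, hpar, -, -⟩ := exists_emod_eight z
  rw [Int.odd_iff, hpar, hz]
  interval_cases r <;> decide

/-- `z` is even iff `z mod 8 ∈ {0, 2, 4, 6}`. [folklore] -/
theorem even_iff_cast_zmod_eight (z : ℤ) :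
    Even z ↔ ((z : ZMod 8) = 0 ∨ (z : ZMod 8) = 2 ∨ (z : ZMod 8) = 4 ∨ (z : ZMod 8) = 6) := by
  obtain ⟨r, hr0, hr8, hz, hpar, -, -⟩ := exists_emod_eight z
  rw [Int.even_iff, hpar, hz]
  interval_cases r <;> decide

/-- Mod-8 table for `a² + 3b² = 2c²`: every solution in `ℤ/8` has `a, b, c` all even. [folklore] -/
theorem zmod_eight_sq_add_three_mul_sq :
    ∀ a b c : ZMod 8, a ^ 2 + 3 * b ^ 2 = 2 * c ^ 2 →
      (a = 0 ∨ a = 2 ∨ a = 4 ∨ a = 6) ∧ (b = 0 ∨ b = 2 ∨ b = 4 ∨ b = 6) ∧ (c = 0 ∨ c = 2 ∨ c = 4 ∨ c = 6) := by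
  decide

/-- Mod-8 table for `a² + 7b² = 2c²`: every solution in `ℤ/8` has `a, b, c` all even, or `a, b` odd and `c` even. [folklore] -/
theorem zmod_eight_sq_add_seven_mul_sq :
    ∀ a b c : ZMod 8, a ^ 2 + 7 * b ^ 2 = 2 * c ^ 2 →
      ((a = 0 ∨ a = 2 ∨ a = 4 ∨ a = 6) ∧ (b = 0 ∨ b = 2 ∨ b = 4 ∨ b = 6) ∧ (c = 0 ∨ c = 2 ∨ c = 4 ∨ c = 6)) ∨
      ((a = 1 ∨ a = 3 ∨ a = 5 ∨ a = 7) ∧ (b = 1 ∨ b = 3 ∨ b = 5 ∨ b = 7) ∧ (c = 0 ∨ c = 2 ∨ c = 4 ∨ c = 6)) := by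
  decide

/-- Mod-8 table for `b² = 2a² + c²`: every solution in `ℤ/8` has `a, b, c` all even, or `a` even and `b, c` odd. [folklore] -/
theorem zmod_eight_sq_eq_two_mul_sq_add_sq :
    ∀ a b c : ZMod 8, b ^ 2 = 2 * a ^ 2 + c ^ 2 →
      ((a = 0 ∨ a = 2 ∨ a = 4 ∨ a = 6) ∧ (b = 0 ∨ b = 2 ∨ b = 4 ∨ b = 6) ∧ (c = 0 ∨ c = 2 ∨ c = 4 ∨ c = 6)) ∨
      ((a = 0 ∨ a = 2 ∨ a = 4 ∨ a = 6) ∧ (b = 1 ∨ b = 3 ∨ b = 5 ∨ b = 7) ∧ (c = 1 ∨ c = 3 ∨ c = 5 ∨ c = 7)) := by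
  decide

/-- **Normalisation (ii) of §59.13(b).** A 2-primitive integer solution of `u² + p·w² = 2m²` with `p ≡ 3 (mod 4)` has `u, w` odd
and `m` even, and forces `p ≡ 7 (mod 8)` (for `p ≡ 3 (mod 8)` there is no 2-primitive solution).  In E-es-185 this makes `t = u`
odd and `s = m` even in the roots `e₁, e₁ + u², e₁ + 2m²`. [cite: Stevens1989, §2] -/
theorem parity_of_sq_add_mul_sq_eq_two_mul_sq {p u w m : ℤ} (hp : p % 4 = 3) (h : u ^ 2 + p * w ^ 2 = 2 * m ^ 2)
    (hprim : ¬ (2 ∣ u ∧ 2 ∣ w ∧ 2 ∣ m)) : Odd u ∧ Odd w ∧ Even m ∧ p % 8 = 7 := by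
  have h8 : (u : ZMod 8) ^ 2 + (p : ZMod 8) * (w : ZMod 8) ^ 2 = 2 * (m : ZMod 8) ^ 2 := by exact_mod_cast congrArg (Int.cast : ℤ → ZMod 8) h
  obtain ⟨r, hr0, hr8, hpr, -, hp4, hp8⟩ := exists_emod_eight p
  have hr : r = 3 ∨ r = 7 := by omega
  have hprim' : ¬ (((u : ZMod 8) = 0 ∨ (u : ZMod 8) = 2 ∨ (u : ZMod 8) = 4 ∨ (u : ZMod 8) = 6) ∧
      ((w : ZMod 8) = 0 ∨ (w : ZMod 8) = 2 ∨ (w : ZMod 8) = 4 ∨ (w : ZMod 8) = 6) ∧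
      ((m : ZMod 8) = 0 ∨ (m : ZMod 8) = 2 ∨ (m : ZMod 8) = 4 ∨ (m : ZMod 8) = 6)) := by
    rw [← even_iff_cast_zmod_eight, ← even_iff_cast_zmod_eight, ← even_iff_cast_zmod_eight,
      even_iff_two_dvd, even_iff_two_dvd, even_iff_two_dvd]
    exact hprim
  rcases hr with rfl | rfl
  · rw [hpr, show ((3 : ℤ) : ZMod 8) = 3 by rfl] at h8
    exact absurd (zmod_eight_sq_add_three_mul_sq _ _ _ h8) hprim'
  · rw [hpr, show ((7 : ℤ) : ZMod 8) = 7 by rfl] at h8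
    rcases zmod_eight_sq_add_seven_mul_sq _ _ _ h8 with hall | ⟨hu, hw, hm⟩
    · exact absurd hall hprim'
    · exact ⟨(odd_iff_cast_zmod_eight u).mpr hu, (odd_iff_cast_zmod_eight w).mpr hw,
        (even_iff_cast_zmod_eight m).mpr hm, hp8⟩

/-- **Normalisation (iii-h₁) of §59.13(b).** A 2-primitive integer solution of `b² = 2a² + c²` has `a` even and `b, c` odd
(differences of squares mod `8` lie in `{0,1,3,4,5,7} ∌ 2`).  In E-es-185 this makes `s = a` even and `t = b` odd in the roots of
`y² = x(x − 2a²)(x − b²)`. [cite: Stevens1989, §2] -/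
theorem parity_of_sq_eq_two_mul_sq_add_sq {a b c : ℤ} (h : b ^ 2 = 2 * a ^ 2 + c ^ 2)
    (hprim : ¬ (2 ∣ a ∧ 2 ∣ b ∧ 2 ∣ c)) : Even a ∧ Odd b ∧ Odd c := by
  have h8 : (b : ZMod 8) ^ 2 = 2 * (a : ZMod 8) ^ 2 + (c : ZMod 8) ^ 2 := by exact_mod_cast congrArg (Int.cast : ℤ → ZMod 8) h
  have hprim' : ¬ (((a : ZMod 8) = 0 ∨ (a : ZMod 8) = 2 ∨ (a : ZMod 8) = 4 ∨ (a : ZMod 8) = 6) ∧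
      ((b : ZMod 8) = 0 ∨ (b : ZMod 8) = 2 ∨ (b : ZMod 8) = 4 ∨ (b : ZMod 8) = 6) ∧
      ((c : ZMod 8) = 0 ∨ (c : ZMod 8) = 2 ∨ (c : ZMod 8) = 4 ∨ (c : ZMod 8) = 6)) := by
    rw [← even_iff_cast_zmod_eight, ← even_iff_cast_zmod_eight, ← even_iff_cast_zmod_eight,
      even_iff_two_dvd, even_iff_two_dvd, even_iff_two_dvd]
    exact hprim
  rcases zmod_eight_sq_eq_two_mul_sq_add_sq _ _ _ h8 with hall | ⟨ha, hb, hc⟩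
  · exact absurd hall hprim'
  · exact ⟨(even_iff_cast_zmod_eight a).mpr ha, (odd_iff_cast_zmod_eight b).mpr hb, (odd_iff_cast_zmod_eight c).mpr hc⟩

end Summit.BirchSwinnertonDyer.BirchSwinnertonDyer.Theorems.ManinLocalTwoThree.KummerDiamondShape

end
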